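import Literature.NumberTheory.NumberFields.SplitPrimesGaloisClosure
import HarnessLib

/-!
# A ring endomorphism of a number field fixing every prime ideal is the identity

Classical algebraic number theory (e.g. Neukirch, *Algebraic Number Theory*, Ch. I §8–§9; the statement
is the triviality of the kernel of the action of `Aut(L)` on the set of primes of `L`): **if `τ : L →+* L`
satisfies `τ⁻¹(𝔓) = 𝔓` for every maximal ideal `𝔓` of `𝓞_L`, then `τ = id`.**

Proof (elementary, no Chebotarev beyond what the tree already has): for a rational prime `p` that
SPLITS COMPLETELY in `L` (infinitely many exist — `Literature.NumberTheory.NumberFields.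
infinite_setOf_splitsCompletely`, itself from the tree's kernel Chebotarev) and any prime `𝔓 ∣ p` of
`𝓞_L`, the residue field `𝓞_L/𝔓 ≅ 𝔽_p` has no non-trivial ring endomorphism, so the endomorphism of
`𝓞_L/𝔓` induced by `τ` (which exists since `τ⁻¹(𝔓) = 𝔓`) is the identity: `τ x − x ∈ 𝔓` for all
`x ∈ 𝓞_L`, whence `p = N𝔓 ∣ N(τ x − x)`. Infinitely many `p` divide `N(τ x − x)`, so `τ x = x`.

PROOF-ONLY file (no definitions; seat abc-iut-w5-d048, cell abc-iut, sub-row (2) of L1-lead R111 (2)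
«C54-core-arith»: it supplies the step «an endomorphism of `Spec L` in the base category `FinSubextCat F K`
of [FrdI] Ex. 6.3 acting trivially on arithmetic divisors is the identity» of the hom-rigidity of the
realification functor `C_{K/F}^un-tr → C_{K/F}^rlf`). Nothing here is specific to, or takes a side on,
the disputed corpus.
-/

noncomputable section

open NumberField IsDedekindDomain Ideal
open Literature.NumberTheory.GaloisRepresentations

namespace Literature.NumberTheory.NumberFields

variable {L : Type} [Field L] [NumberField L]

/-- For a prime `𝔓` of `𝓞_L` with prime residue cardinality `p` and a ring endomorphism `τ'` of `𝓞_L`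
with `τ'⁻¹(𝔓) = 𝔓`: `τ' x ≡ x (mod 𝔓)` for every `x` — the field `𝓞_L/𝔓 ≅ ℤ/p` has only the identity
as ring endomorphism. [folklore] -/
private theorem sub_mem_of_comap_eq_of_absNorm_prime (τ' : 𝓞 L →+* 𝓞 L) (P : Ideal (𝓞 L)) [P.IsMaximal]
    (hP : (absNorm P).Prime) (hτ : P.comap τ' = P) (x : 𝓞 L) : τ' x - x ∈ P := by
  -- the induced endomorphism of the residue field
  let τbar : 𝓞 L ⧸ P →+* 𝓞 L ⧸ P := Ideal.quotientMap P τ' hτ.symm.le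
  have hbar : τbar (Ideal.Quotient.mk P x) = Ideal.Quotient.mk P (τ' x) := Ideal.quotientMap_mk
  -- `𝓞_L / 𝔓` is a ring with `p` elements, `p` prime: it receives a SURJECTIVE map from `ZMod p`, and ring
  -- maps out of `ZMod p` are unique
  have hPbot : P ≠ ⊥ := by
    rintro rfl
    rw [absNorm_bot] at hP
    exact Nat.not_prime_zero hP
  haveI : Finite (𝓞 L ⧸ P) := P.finiteQuotientOfFreeOfNeBot hPbot
  letI : Fintype (𝓞 L ⧸ P) := Fintype.ofFinite _
  have hcard : Fintype.card (𝓞 L ⧸ P) = absNorm P := by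
    rw [← Nat.card_eq_fintype_card, absNorm_apply, Submodule.cardQuot_apply]
  let e : ZMod (absNorm P) ≃+* 𝓞 L ⧸ P := ZMod.ringEquivOfPrime (𝓞 L ⧸ P) hP hcard
  have hcomp : τbar.comp e.toRingHom = e.toRingHom := Subsingleton.elim _ _
  have hfix : ∀ z : 𝓞 L ⧸ P, τbar z = z := fun z => by
    obtain ⟨w, rfl⟩ := e.surjective z
    exact congrArg (fun f : ZMod (absNorm P) →+* 𝓞 L ⧸ P => f w) hcomp
  rw [← Ideal.Quotient.eq, ← hbar, hfix]

/-- If `y ∈ 𝔓` then `N𝔓 ∣ |N_{L/ℚ}(y)|`. [folklore] -/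
private theorem absNorm_dvd_natAbs_norm_of_mem {P : Ideal (𝓞 L)} {y : 𝓞 L} (hy : y ∈ P) :
    absNorm P ∣ (Algebra.norm ℤ y).natAbs := by
  rw [← absNorm_span_singleton]
  exact absNorm_dvd_absNorm_of_le ((span_singleton_le_iff_mem _).mpr hy)

/-- For a completely split rational prime `p` and `τ'` fixing every maximal ideal of `𝓞_L`:
`p ∣ |N(τ' x − x)|`. [folklore] -/
private theorem dvd_natAbs_norm_sub_of_splitsCompletely (τ' : 𝓞 L →+* 𝓞 L)
    (hτ : ∀ P : Ideal (𝓞 L), P.IsMaximal → P.comap τ' = P) {p : ℕ} (hp : p.Prime)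
    (hsplit : SplitsCompletely L p) (x : 𝓞 L) : p ∣ (Algebra.norm ℤ (τ' x - x)).natAbs := by
  -- a prime `𝔓` of `𝓞_L` above `p`
  haveI hpI : (span {(p : ℤ)}).IsPrime :=
    (span_singleton_prime (by exact_mod_cast hp.ne_zero)).mpr (Nat.prime_iff_prime_int.mp hp)
  obtain ⟨⟨P, hPprime, hPover⟩⟩ := (inferInstance : Nonempty ((span {(p : ℤ)}).primesOver (𝓞 L)))
  have hpbot : span {(p : ℤ)} ≠ ⊥ :=
    mt Ideal.span_singleton_eq_bot.mp (by exact_mod_cast hp.ne_zero)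
  have hPbot : P ≠ ⊥ := Ideal.ne_bot_of_liesOver_of_ne_bot hpbot P
  haveI : P.IsMaximal := hPprime.isMaximal hPbot
  -- its residue cardinality is `p`
  have hpmem : ((p : ℕ) : 𝓞 L) ∈ P := by
    have h1 : (p : ℤ) ∈ P.under ℤ := by
      rw [← hPover.over]; exact mem_span_singleton_self _
    have h2 := (mem_comap.mp h1 : algebraMap ℤ (𝓞 L) (p : ℤ) ∈ P)
    simpa using h2
  have hcardP : absNorm P = p := by
    have := hsplit.2 ⟨P, hPprime, hPbot⟩ hpmem
    simpa [HeightOneSpectrum.residueCard] using this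
  have hmem := sub_mem_of_comap_eq_of_absNorm_prime τ' P (hcardP ▸ hp) (hτ P inferInstance) x
  simpa [hcardP] using absNorm_dvd_natAbs_norm_of_mem hmem

/-- **A ring endomorphism of `𝓞_L` fixing every maximal ideal is the identity.** Classical; it is the number-theoretic input of the 1-uniqueness clause of [FrdI] Cor. 5.4 at the arithmetic Frobenioid `C_{K/F}` of Thm. 6.4 (an endomorphism of `Spec L` in the base category acting trivially on arithmetic divisors is the identity). [cite: MochizukiFrdI2008, Cor. 5.4 p.104] -/
theorem ringOfIntegers_ringHom_eq_id_of_forall_comap_eq (τ' : 𝓞 L →+* 𝓞 L)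
    (hτ : ∀ P : Ideal (𝓞 L), P.IsMaximal → P.comap τ' = P) : τ' = RingHom.id (𝓞 L) := by
  refine RingHom.ext fun x => ?_
  rw [RingHom.id_apply, ← sub_eq_zero]
  by_contra hy
  -- `N(τ' x − x) ≠ 0`, so only finitely many primes divide it …
  have hN : Algebra.norm ℤ (τ' x - x) ≠ 0 := Algebra.norm_ne_zero_iff.mpr hy
  have hfin : {p : ℕ | p.Prime ∧ p ∣ (Algebra.norm ℤ (τ' x - x)).natAbs}.Finite := by
    refine (Finset.finite_toSet (Algebra.norm ℤ (τ' x - x)).natAbs.primeFactors).subset ?_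
    rintro p ⟨hp, hdvd⟩
    exact Nat.mem_primeFactors.mpr ⟨hp, hdvd, Int.natAbs_ne_zero.mpr hN⟩
  -- … but every completely split prime divides it, and there are infinitely many
  refine (infinite_setOf_splitsCompletely L).mono ?_ |>.not_finite hfin |>.elim
  rintro p ⟨hp, hsplit⟩
  exact ⟨hp, dvd_natAbs_norm_sub_of_splitsCompletely τ' hτ hp hsplit x⟩

/-- **A ring endomorphism of a number field `L` whose restriction to `𝓞_L` fixes every maximal ideal is
the identity.** Classical; it is the number-theoretic input of the 1-uniqueness clause of [FrdI] Cor. 5.4 at the arithmetic Frobenioid `C_{K/F}` of Thm. 6.4 (an endomorphism of `Spec L` in the base category acting trivially on arithmetic divisors is the identity). [cite: MochizukiFrdI2008, Cor. 5.4 p.104] -/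
theorem ringHom_eq_id_of_forall_comap_eq (τ : L →+* L)
    (hτ : ∀ P : Ideal (𝓞 L), P.IsMaximal → P.comap (RingOfIntegers.mapRingHom τ) = P) :
    τ = RingHom.id L := by
  have hO : RingOfIntegers.mapRingHom τ = RingHom.id (𝓞 L) :=
    ringOfIntegers_ringHom_eq_id_of_forall_comap_eq _ hτ
  refine IsLocalization.ringHom_ext (nonZeroDivisors (𝓞 L)) (RingHom.ext fun x => ?_)
  have hx := congrArg (fun f : 𝓞 L →+* 𝓞 L => ((f x : 𝓞 L) : L)) hO
  simpa using hx

/-- The same for the finite places (`HeightOneSpectrum`): if `τ⁻¹(v) = v` for every nonzero prime `v` of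
`𝓞_L` then `τ = id`. Classical; it is the number-theoretic input of the 1-uniqueness clause of [FrdI] Cor. 5.4 at the arithmetic Frobenioid `C_{K/F}` of Thm. 6.4 (an endomorphism of `Spec L` in the base category acting trivially on arithmetic divisors is the identity). [cite: MochizukiFrdI2008, Cor. 5.4 p.104] -/
theorem ringHom_eq_id_of_forall_comap_heightOneSpectrum (τ : L →+* L)
    (hτ : ∀ v : HeightOneSpectrum (𝓞 L),
      v.asIdeal.comap (RingOfIntegers.mapRingHom τ) = v.asIdeal) :
    τ = RingHom.id L := by
  refine ringHom_eq_id_of_forall_comap_eq τ fun P hP => ?_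
  by_cases hbot : P = ⊥
  · subst hbot
    exact Ideal.comap_bot_of_injective _
      (fun a b h => RingOfIntegers.ext (τ.injective (by simpa using congrArg (fun z : 𝓞 L => (z : L)) h)))
  · exact hτ ⟨P, hP.isPrime, hbot⟩

/-- Algebra-equivalence form: an automorphism `τ : L ≃ₐ[F] L` over any subfield `F` fixing every finite
place is the identity. Classical; it is the number-theoretic input of the 1-uniqueness clause of [FrdI] Cor. 5.4 at the arithmetic Frobenioid `C_{K/F}` of Thm. 6.4 (an endomorphism of `Spec L` in the base category acting trivially on arithmetic divisors is the identity). [cite: MochizukiFrdI2008, Cor. 5.4 p.104] -/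
theorem algEquiv_eq_refl_of_forall_comap_heightOneSpectrum {F : Type*} [Field F] [Algebra F L]
    (τ : L ≃ₐ[F] L)
    (hτ : ∀ v : HeightOneSpectrum (𝓞 L),
      v.asIdeal.comap (RingOfIntegers.mapRingHom (τ : L →+* L)) = v.asIdeal) :
    τ = AlgEquiv.refl := by
  apply AlgEquiv.ext
  intro x
  have h := ringHom_eq_id_of_forall_comap_heightOneSpectrum (τ : L →+* L) hτ
  exact congrArg (fun f : L →+* L => f x) h

/-- Algebra-homomorphism form (the shape of the morphisms `Spec L → Spec L` of [FrdI] Ex. 6.3's base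
category): `σ : L →ₐ[F] L` fixing every finite place is the identity. Classical; it is the number-theoretic input of the 1-uniqueness clause of [FrdI] Cor. 5.4 at the arithmetic Frobenioid `C_{K/F}` of Thm. 6.4 (an endomorphism of `Spec L` in the base category acting trivially on arithmetic divisors is the identity). [cite: MochizukiFrdI2008, Cor. 5.4 p.104] -/
theorem algHom_eq_id_of_forall_comap_heightOneSpectrum {F : Type*} [Field F] [Algebra F L]
    (σ : L →ₐ[F] L)
    (hσ : ∀ v : HeightOneSpectrum (𝓞 L),
      v.asIdeal.comap (RingOfIntegers.mapRingHom (σ : L →+* L)) = v.asIdeal) :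
    σ = AlgHom.id F L := by
  apply AlgHom.ext
  intro x
  have h := ringHom_eq_id_of_forall_comap_heightOneSpectrum (σ : L →+* L) hσ
  exact congrArg (fun f : L →+* L => f x) h

end Literature.NumberTheory.NumberFields

end
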